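import Summits.CriticalPhenomena.Ising3DConformalLimit.Theorems.FKParityRobustnessIndependentStrandsJoinR1SecondMomentCurrents
import Literature.Probability.LatticeModels.CurrentExploration
import Literature.Probability.LatticeModels.DoubleCurrents
import Literature.Probability.LatticeModels.IsingThermodynamics
import Literature.Probability.LatticeModels.IntersectionSecondMoment
import Literature.Probability.LatticeModels.SourcedCurrentLaw
import HarnessLib

/-!
# Crux `WindowForcesU4` (stmt-CriticalPhenomena-5505), line `backbone-thinning-window` (reshape r1) —
# stub `stub_backboneCauchySchwarz`: the second-moment inequality for backbone intersections

`--supports` file of the registered stub `stub_backboneCauchySchwarz` of the skeleton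
`Cruxes/WindowForcesU4` (line `backbone-thinning-window`, reshape r1, lead c3).

**Statement.**  In the free box `Λ_n ⊂ ℤ³` at `β = β_c(3)`, let `n₁ ~ P^{ab} = currentLaw _ β ({a} ∆ {b})` and
`n₂ ~ P^{a'b'}` be two INDEPENDENT single sourced currents (their joint law is the tree's
`doubleCurrentMeasure _ β ({a} ∆ {b}) ({a'} ∆ {b'}) = P^{ab} ⊗ P^{a'b'}`), let
`Γ₁ = vis (Current.explore rk n₁ {b} a)` and `Γ₂ = vis (Current.explore rk n₂ {b'} a')` be their Aizenman
backbones (visited sets of the deterministic exploration walk, `CurrentExploration.lean`), and for a finite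
set `A` of box vertices let `N = #(Γ₁ ∩ Γ₂ ∩ A)`.  Then
`E[N]² ≤ P[Γ₁ ∩ Γ₂ ≠ ∅] · E[N²]`, with both moments FACTORISED over the two independent currents:
`E[N] = Σ_{u ∈ A} P^{ab}[u ∈ Γ₁] P^{a'b'}[u ∈ Γ₂]`, `E[N²] = Σ_{u,v ∈ A} P^{ab}[u,v ∈ Γ₁] P^{a'b'}[u,v ∈ Γ₂]`.

**Proof.**  Proved for every finite graph, every `β ≥ 0` and ARBITRARY set-valued observables
`Γ₁ Γ₂ : Current G → Finset V` (prefix `bcs_`), then specialised.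
(1) `doubleCurrentMeasure G β A C = P^A ⊗ P^C` on sets (`smc_doubleCurrentMeasure_apply`, imported from
`Theorems/FKParityRobustnessIndependentStrandsJoinR1SecondMomentCurrents`) and products of `currentLaw`-masses
are series over pairs (`smc_currentLaw_mul_currentLaw`); hence by Fubini both moments are the `ℝ≥0∞` series
`Σ' p, P^A{p₁} P^C{p₂} N(p)^k`, `k = 1, 2` (`bcs_firstMoment`, `bcs_secondMoment`).
(2) `{N ≠ 0} ⊆ {Γ₁ ∩ Γ₂ ≠ ∅}`: a site `u ∈ A` counted by `N` lies in `Γ₁(p₁) ∩ Γ₂(p₂)` (`bcs_indicator_le_meet`).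
(3) Cauchy–Schwarz `E[N]² = E[N 𝟙_{N ≠ 0}]² ≤ P[N ≠ 0] E[N²]` (tree
`Current.tsum_mul_sq_le_tsum_indicator_mul_tsum_sq`; Aizenman–Duminil-Copin 2021, proof of Lemma 4.4), and
everything is finite (`smc_currentLaw_ne_top`, `smc_doubleCurrentMeasure_ne_top`), so the inequality descends
to `Measure.real`.  Degenerate normalisers need no case split (`currentLaw`, `doubleCurrentMeasure` are then `0`).
Finally `β_c(3) ≥ 0` (`criticalBeta_nonneg`).

Theorem-only file (no definitions).  References: M. Aizenman, Comm. Math. Phys. 86 (1982), §9;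
M. Aizenman, H. Duminil-Copin, Ann. of Math. 194 (2021) = arXiv:1912.07973, §4.2, proof of Lemma 4.4
[AizenmanDuminilCopinAnnals2021]; H. Duminil-Copin, arXiv:1607.06933, Def. 3.2 [DuminilCopin2016].
-/

noncomputable section

open Finset MeasureTheory
open Literature.Probability.LatticeModels Literature.Probability.Percolation
open scoped ENNReal symmDiff

namespace Summit.CriticalPhenomena.Ising3DConformalLimit.LatticeSDPCertificatesWindowForcesU4.BackboneCauchySchwarzProof

open Summit.CriticalPhenomena.Ising3DConformalLimit.Theorems.StubSecondMomentCurrents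
  (smc_doubleCurrentMeasure_apply smc_currentLaw_mul_currentLaw smc_currentLaw_ne_top smc_doubleCurrentMeasure_ne_top)

section Generic

open scoped Classical

variable {V : Type*} [Fintype V] [DecidableEq V] (G : SimpleGraph V) [DecidableRel G.Adj]

/-- **First moment factorised** (`ℝ≥0∞`), for arbitrary set-valued observables `Γ₁, Γ₂` of the two currents:
`Σ_{u ∈ B} P^A[u ∈ Γ₁] · P^C[u ∈ Γ₂] = Σ' p, P^A{p₁} P^C{p₂} · N(p)`, `N(p) = #{u ∈ B : u ∈ Γ₁(p₁) ∩ Γ₂(p₂)}`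
— `E[N]` under `P^A ⊗ P^C` by Fubini. [cite: AizenmanDuminilCopinAnnals2021, §4.2, proof of Lemma 4.4] -/
theorem bcs_firstMoment_enn (β : ℝ) (A C : Finset V) (Γ₁ Γ₂ : Current G → Finset V) (B : Finset V) :
    ∑ u ∈ B, currentLaw G β A {n | u ∈ Γ₁ n} * currentLaw G β C {n | u ∈ Γ₂ n} =
      ∑' p : Current G × Current G,
        ENNReal.ofReal (currentProb G β A p.1) * ENNReal.ofReal (currentProb G β C p.2) *
          ∑ u ∈ B, (if u ∈ Γ₁ p.1 ∧ u ∈ Γ₂ p.2 then (1 : ℝ≥0∞) else 0) := by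
  simp_rw [Finset.mul_sum]
  rw [Summable.tsum_finsetSum (fun _ _ => ENNReal.summable)]
  refine Finset.sum_congr rfl fun u _ => ?_
  rw [smc_currentLaw_mul_currentLaw]
  refine tsum_congr fun p => ?_
  by_cases h1 : u ∈ Γ₁ p.1 <;> by_cases h2 : u ∈ Γ₂ p.2 <;> simp [h1, h2]

/-- **Second moment factorised** (`ℝ≥0∞`):
`Σ_{u,v ∈ B} P^A[u,v ∈ Γ₁] · P^C[u,v ∈ Γ₂] = Σ' p, P^A{p₁} P^C{p₂} · N(p)²` — `E[N²]` under `P^A ⊗ P^C`.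
[cite: AizenmanDuminilCopinAnnals2021, §4.2, proof of Lemma 4.4] -/
theorem bcs_secondMoment_enn (β : ℝ) (A C : Finset V) (Γ₁ Γ₂ : Current G → Finset V) (B : Finset V) :
    ∑ u ∈ B, ∑ v ∈ B, currentLaw G β A {n | u ∈ Γ₁ n ∧ v ∈ Γ₁ n} *
        currentLaw G β C {n | u ∈ Γ₂ n ∧ v ∈ Γ₂ n} =
      ∑' p : Current G × Current G,
        ENNReal.ofReal (currentProb G β A p.1) * ENNReal.ofReal (currentProb G β C p.2) *
          (∑ u ∈ B, (if u ∈ Γ₁ p.1 ∧ u ∈ Γ₂ p.2 then (1 : ℝ≥0∞) else 0)) ^ 2 := by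
  have hsq : ∀ p : Current G × Current G,
      ENNReal.ofReal (currentProb G β A p.1) * ENNReal.ofReal (currentProb G β C p.2) *
          (∑ u ∈ B, (if u ∈ Γ₁ p.1 ∧ u ∈ Γ₂ p.2 then (1 : ℝ≥0∞) else 0)) ^ 2 =
        ∑ u ∈ B, ∑ v ∈ B,
          ENNReal.ofReal (currentProb G β A p.1) * ENNReal.ofReal (currentProb G β C p.2) *
            ((if u ∈ Γ₁ p.1 ∧ u ∈ Γ₂ p.2 then (1 : ℝ≥0∞) else 0) *
              (if v ∈ Γ₁ p.1 ∧ v ∈ Γ₂ p.2 then (1 : ℝ≥0∞) else 0)) := fun p => by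
    rw [sq, Finset.sum_mul_sum, Finset.mul_sum]
    refine Finset.sum_congr rfl fun u _ => ?_
    rw [Finset.mul_sum]
  simp_rw [hsq]
  rw [Summable.tsum_finsetSum (fun _ _ => ENNReal.summable)]
  refine Finset.sum_congr rfl fun u _ => ?_
  rw [Summable.tsum_finsetSum (fun _ _ => ENNReal.summable)]
  refine Finset.sum_congr rfl fun v _ => ?_
  rw [smc_currentLaw_mul_currentLaw]
  refine tsum_congr fun p => ?_
  by_cases h1 : u ∈ Γ₁ p.1 <;> by_cases h2 : v ∈ Γ₁ p.1 <;>
    by_cases h3 : u ∈ Γ₂ p.2 <;> by_cases h4 : v ∈ Γ₂ p.2 <;> simp [h1, h2, h3, h4]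

/-- **First moment factorised**, real form: `E₁ = Σ_{u ∈ B} P^A[u ∈ Γ₁] P^C[u ∈ Γ₂] = (Σ' P P N).toReal`
(`β ≥ 0`). [cite: AizenmanDuminilCopinAnnals2021, §4.2, proof of Lemma 4.4] -/
theorem bcs_firstMoment {β : ℝ} (hβ : 0 ≤ β) (A C : Finset V) (Γ₁ Γ₂ : Current G → Finset V)
    (B : Finset V) :
    ∑ u ∈ B, (currentLaw G β A).real {n | u ∈ Γ₁ n} * (currentLaw G β C).real {n | u ∈ Γ₂ n} =
      (∑' p : Current G × Current G,
        ENNReal.ofReal (currentProb G β A p.1) * ENNReal.ofReal (currentProb G β C p.2) *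
          ∑ u ∈ B, (if u ∈ Γ₁ p.1 ∧ u ∈ Γ₂ p.2 then (1 : ℝ≥0∞) else 0)).toReal := by
  rw [← bcs_firstMoment_enn, ENNReal.toReal_sum (fun u _ =>
    ENNReal.mul_ne_top (smc_currentLaw_ne_top G hβ A _) (smc_currentLaw_ne_top G hβ C _))]
  refine Finset.sum_congr rfl fun u _ => ?_
  rw [measureReal_def, measureReal_def, ENNReal.toReal_mul]

/-- **Second moment factorised**, real form:
`E₂ = Σ_{u,v ∈ B} P^A[u,v ∈ Γ₁] P^C[u,v ∈ Γ₂] = (Σ' P P N²).toReal` (`β ≥ 0`).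
[cite: AizenmanDuminilCopinAnnals2021, §4.2, proof of Lemma 4.4] -/
theorem bcs_secondMoment {β : ℝ} (hβ : 0 ≤ β) (A C : Finset V) (Γ₁ Γ₂ : Current G → Finset V)
    (B : Finset V) :
    ∑ u ∈ B, ∑ v ∈ B, (currentLaw G β A).real {n | u ∈ Γ₁ n ∧ v ∈ Γ₁ n} *
        (currentLaw G β C).real {n | u ∈ Γ₂ n ∧ v ∈ Γ₂ n} =
      (∑' p : Current G × Current G,
        ENNReal.ofReal (currentProb G β A p.1) * ENNReal.ofReal (currentProb G β C p.2) *
          (∑ u ∈ B, (if u ∈ Γ₁ p.1 ∧ u ∈ Γ₂ p.2 then (1 : ℝ≥0∞) else 0)) ^ 2).toReal := by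
  have hfin : ∀ u v : V, currentLaw G β A {n | u ∈ Γ₁ n ∧ v ∈ Γ₁ n} *
      currentLaw G β C {n | u ∈ Γ₂ n ∧ v ∈ Γ₂ n} ≠ ∞ := fun u v =>
    ENNReal.mul_ne_top (smc_currentLaw_ne_top G hβ A _) (smc_currentLaw_ne_top G hβ C _)
  rw [← bcs_secondMoment_enn, ENNReal.toReal_sum (fun u _ => ENNReal.sum_ne_top.2 fun v _ => hfin u v)]
  refine Finset.sum_congr rfl fun u _ => ?_
  rw [ENNReal.toReal_sum (fun v _ => hfin u v)]
  refine Finset.sum_congr rfl fun v _ => ?_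
  rw [measureReal_def, measureReal_def, ENNReal.toReal_mul]

/-- The second moment series is finite (`β ≥ 0`). [cite: AizenmanDuminilCopinAnnals2021, §4.2, proof of Lemma 4.4] -/
theorem bcs_secondMoment_ne_top {β : ℝ} (hβ : 0 ≤ β) (A C : Finset V) (Γ₁ Γ₂ : Current G → Finset V)
    (B : Finset V) :
    (∑' p : Current G × Current G,
        ENNReal.ofReal (currentProb G β A p.1) * ENNReal.ofReal (currentProb G β C p.2) *
          (∑ u ∈ B, (if u ∈ Γ₁ p.1 ∧ u ∈ Γ₂ p.2 then (1 : ℝ≥0∞) else 0)) ^ 2) ≠ ∞ := by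
  rw [← bcs_secondMoment_enn]
  exact ENNReal.sum_ne_top.2 fun u _ => ENNReal.sum_ne_top.2 fun v _ =>
    ENNReal.mul_ne_top (smc_currentLaw_ne_top G hβ A _) (smc_currentLaw_ne_top G hβ C _)

/-- **`{N ≠ 0} ⊆ {Γ₁ ∩ Γ₂ ≠ ∅}`** in weighted form:
`Σ' p, P^A{p₁} P^C{p₂} 𝟙[N(p) ≠ 0] ≤ P^A ⊗ P^C [Γ₁(p₁) ∩ Γ₂(p₂) ≠ ∅]` (`β ≥ 0`): a site of `B` counted by `N`
is a common site of `Γ₁(p₁)` and `Γ₂(p₂)`. [cite: AizenmanDuminilCopinAnnals2021, §4.2, proof of Lemma 4.4] -/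
theorem bcs_indicator_le_meet {β : ℝ} (hβ : 0 ≤ β) (A C : Finset V) (Γ₁ Γ₂ : Current G → Finset V)
    (B : Finset V) :
    (∑' p : Current G × Current G,
        ENNReal.ofReal (currentProb G β A p.1) * ENNReal.ofReal (currentProb G β C p.2) *
          (if (∑ u ∈ B, (if u ∈ Γ₁ p.1 ∧ u ∈ Γ₂ p.2 then (1 : ℝ≥0∞) else 0)) = 0 then 0 else 1)) ≤
      doubleCurrentMeasure G β A C {p | (Γ₁ p.1 ∩ Γ₂ p.2).Nonempty} := by
  rw [smc_doubleCurrentMeasure_apply G hβ]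
  refine ENNReal.tsum_le_tsum fun p => ?_
  by_cases hN : (∑ u ∈ B, (if u ∈ Γ₁ p.1 ∧ u ∈ Γ₂ p.2 then (1 : ℝ≥0∞) else 0)) = 0
  · rw [if_pos hN, mul_zero]
    exact bot_le
  · obtain ⟨u, -, hu⟩ := Finset.exists_ne_zero_of_sum_ne_zero hN
    have hmem : u ∈ Γ₁ p.1 ∧ u ∈ Γ₂ p.2 := by
      by_contra h
      exact hu (if_neg h)
    have hp : p ∈ {p : Current G × Current G | (Γ₁ p.1 ∩ Γ₂ p.2).Nonempty} :=
      ⟨u, Finset.mem_inter.2 hmem⟩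
    rw [if_neg hN, mul_one, if_pos hp]

/-- **The second-moment inequality for two independent sourced currents, arbitrary set-valued observables**
(real form, `β ≥ 0`): `E₁² ≤ P^A ⊗ P^C[Γ₁ ∩ Γ₂ ≠ ∅] · E₂`, from Cauchy–Schwarz `E[N]² ≤ P[N ≠ 0] E[N²]`
(`Current.tsum_mul_sq_le_tsum_indicator_mul_tsum_sq`) and `{N ≠ 0} ⊆ {Γ₁ ∩ Γ₂ ≠ ∅}`.
[cite: AizenmanDuminilCopinAnnals2021, §4.2, proof of Lemma 4.4] -/
theorem bcs_firstMoment_sq_le {β : ℝ} (hβ : 0 ≤ β) (A C : Finset V) (Γ₁ Γ₂ : Current G → Finset V)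
    (B : Finset V) :
    (∑ u ∈ B, (currentLaw G β A).real {n | u ∈ Γ₁ n} * (currentLaw G β C).real {n | u ∈ Γ₂ n}) ^ 2 ≤
      (doubleCurrentMeasure G β A C).real {p | (Γ₁ p.1 ∩ Γ₂ p.2).Nonempty} *
        ∑ u ∈ B, ∑ v ∈ B, (currentLaw G β A).real {n | u ∈ Γ₁ n ∧ v ∈ Γ₁ n} *
          (currentLaw G β C).real {n | u ∈ Γ₂ n ∧ v ∈ Γ₂ n} := by
  rw [bcs_firstMoment G hβ, bcs_secondMoment G hβ, measureReal_def, ← ENNReal.toReal_pow,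
    ← ENNReal.toReal_mul]
  refine ENNReal.toReal_mono
    (ENNReal.mul_ne_top (smc_doubleCurrentMeasure_ne_top G hβ A C _)
      (bcs_secondMoment_ne_top G hβ A C Γ₁ Γ₂ B)) ?_
  refine (Current.tsum_mul_sq_le_tsum_indicator_mul_tsum_sq
    (fun p : Current G × Current G =>
      ENNReal.ofReal (currentProb G β A p.1) * ENNReal.ofReal (currentProb G β C p.2))
    (fun p : Current G × Current G =>
      ∑ u ∈ B, (if u ∈ Γ₁ p.1 ∧ u ∈ Γ₂ p.2 then (1 : ℝ≥0∞) else 0))).trans ?_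
  exact mul_le_mul' (bcs_indicator_le_meet G hβ A C Γ₁ Γ₂ B) le_rfl

end Generic

/-- **Registered stub `stub_backboneCauchySchwarz` (SECOND-MOMENT INEQUALITY FOR BACKBONE INTERSECTIONS) of the
line `backbone-thinning-window` (reshape r1) of crux `WindowForcesU4` (stmt-CriticalPhenomena-5505).**  In the
free box `Λ_n ⊂ ℤ³` at `β_c(3)`, for the product law `P^{ab} ⊗ P^{a'b'} = doubleCurrentMeasure` of two
independent single sourced critical currents and any finite set `A` of box vertices, with
`Γ₁ = vis (explore rk n₁ {b} a)`, `Γ₂ = vis (explore rk n₂ {b'} a')` and `N = #(Γ₁ ∩ Γ₂ ∩ A)`: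
`E[N]² ≤ P[Γ₁ ∩ Γ₂ ≠ ∅] · E[N²]`, both moments factorised over the two independent currents (Cauchy–Schwarz
`E[N]² ≤ P[N ≠ 0] E[N²]` and `{N ≠ 0} ⊆ {Γ₁ ∩ Γ₂ ≠ ∅}`; the generic `bcs_firstMoment_sq_le` at
`G = freeBoxGraph 3 n`, `β = β_c(3) ≥ 0`). [cite: AizenmanDuminilCopinAnnals2021, §4.2, proof of Lemma 4.4] -/
theorem stub_backboneCauchySchwarz :
    ∀ (n : ℕ) (rk : (freeBoxGraph 3 n).edgeFinset → ℕ) (a b a' b' : BoxVertex 3 n) (A : Finset (BoxVertex 3 n)),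
      (∑ u ∈ A, (currentLaw (freeBoxGraph 3 n) (criticalBeta 3) ({a} ∆ {b})).real {m | u ∈ (Current.explore rk m {b} a).vis} *
          (currentLaw (freeBoxGraph 3 n) (criticalBeta 3) ({a'} ∆ {b'})).real {m | u ∈ (Current.explore rk m {b'} a').vis}) ^ 2 ≤
        (doubleCurrentMeasure (freeBoxGraph 3 n) (criticalBeta 3) ({a} ∆ {b}) ({a'} ∆ {b'})).real
            {p | ((Current.explore rk p.1 {b} a).vis ∩ (Current.explore rk p.2 {b'} a').vis).Nonempty} *
          ∑ u ∈ A, ∑ v ∈ A,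
            (currentLaw (freeBoxGraph 3 n) (criticalBeta 3) ({a} ∆ {b})).real
                {m | u ∈ (Current.explore rk m {b} a).vis ∧ v ∈ (Current.explore rk m {b} a).vis} *
              (currentLaw (freeBoxGraph 3 n) (criticalBeta 3) ({a'} ∆ {b'})).real
                {m | u ∈ (Current.explore rk m {b'} a').vis ∧ v ∈ (Current.explore rk m {b'} a').vis} := by
  intro n rk a b a' b' A
  exact bcs_firstMoment_sq_le (freeBoxGraph 3 n) (criticalBeta_nonneg 3) ({a} ∆ {b}) ({a'} ∆ {b'})
    (fun m => (Current.explore rk m {b} a).vis) (fun m => (Current.explore rk m {b'} a').vis) A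

end Summit.CriticalPhenomena.Ising3DConformalLimit.LatticeSDPCertificatesWindowForcesU4.BackboneCauchySchwarzProof

end
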